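import Summits.QuantumFields.YangMills.Theses.FiniteRankMirror
import HarnessLib

/-!
# Route `FiniteRankMirror`, item `Assembly` (stmt-QuantumFields-25641): finite bookkeeping for spatial multiplexing

Helper file (`--supports stmt-QuantumFields-25641`) for the assembly
`FiniteRankMirrorFloor → MirrorCrossDecay → MirrorDefectVanishes → SkewAtFiniteRankUnit → BalabanLadder.NT`.
The assembly manufactures NT's single test function from a finite-rank mirror floor by SPATIAL MULTIPLEXING
(a sum of far-apart translates of the modes).  Everything here is finite bookkeeping over an ABSTRACT kernel
`K : ℤ⁴ → ℤ⁴ → ℝ` (later: the torus mirror kernel `E_T[dens_x∘Θ₀ · dens_y] − E_T dens_x · E_T dens_y`):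

* §1 double sums `Σ_{x,y ∈ s} c_x d_y K(x,y)`: expansion of a finite sum of coefficient functions
  (`sum_sum_sum_coeff_expand`), the counting/sup bound `|ΣΣ| ≤ #A·#B·(sup|c|·sup|d|·sup|K|)`
  (`abs_sum_sum_le_card_mul`), the perturbation bound (`abs_sum_sum_sub_sum_sum_le`);
* §1b re-indexing a double box sum by a lattice translation (`sum_sum_box_shift`);
* §2 counting lattice sites `y` of a box with `‖s·y − c‖ ≤ ρ`: at most `((2ρ + s)/s)⁴` (`card_filter_norm_sub_le`);
* §3–§4 small geometric lemmas in `ℝ⁴` (coordinates of `s·y − t·e₁`, lattice rounding of an offset, the mirror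
  separation vector `(x₀+y₀, x⃗−y⃗)` dominates `|x₀+y₀|` and `|x₁−y₁|`, box membership from a norm bound, the
  window predicate `window_of_near` of a site carrying a translated coefficient);
* §5 room arithmetic: `(4J+2)ℓ + JAℓ^(1−p/8) < T` for all small `ℓ > 0` when `p < 8` (`exists_room`).

Refs: planner plan `assembly_plan_25641.md` (evidence on the item); Friedli–Velenik 2017 §10.4 (translates and
reflection positivity, the chessboard idea).  Pure bookkeeping; nothing here asserts a floor, a ceiling, NT or a mass
gap.
-/

set_option autoImplicit false

noncomputable section

open scoped SchwartzMap
open MeasureTheory Filter Topology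
open Literature.MathematicalPhysics.QuantumFieldTheory Literature.MathematicalPhysics.QuantumLattice
open Literature.Probability.LatticeModels
open Summit.QuantumFields.YangMills.Cruxes.OSLegsFromFemtoAndGap.DlrCollarTransfer

namespace Summit.QuantumFields.YangMills.Theorems.FiniteRankMirror

/-! ## §1 Double sums against an abstract kernel -/

section DoubleSums

variable {X : Type*}

/-- Expansion of the double sum of a finite sum of coefficient functions:
`ΣΣ (Σⱼ cⱼ x)(Σₖ cₖ y) K x y = Σⱼ Σₖ ΣΣ cⱼ x · cₖ y · K x y`. [folklore] -/
theorem sum_sum_sum_coeff_expand {ι : Type*} (T : Finset ι) (s : Finset X) (c : ι → X → ℝ) (K : X → X → ℝ) :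
    ∑ x ∈ s, ∑ y ∈ s, (∑ j ∈ T, c j x) * (∑ k ∈ T, c k y) * K x y =
      ∑ j ∈ T, ∑ k ∈ T, ∑ x ∈ s, ∑ y ∈ s, c j x * c k y * K x y := by
  have e1 : ∀ x y, (∑ j ∈ T, c j x) * (∑ k ∈ T, c k y) * K x y =
      ∑ j ∈ T, ∑ k ∈ T, c j x * c k y * K x y := by
    intro x y
    rw [Finset.sum_mul, Finset.sum_mul]
    refine Finset.sum_congr rfl fun j _ => ?_
    rw [Finset.mul_sum, Finset.sum_mul]
  simp_rw [e1]
  calc ∑ x ∈ s, ∑ y ∈ s, ∑ j ∈ T, ∑ k ∈ T, c j x * c k y * K x y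
      = ∑ x ∈ s, ∑ j ∈ T, ∑ y ∈ s, ∑ k ∈ T, c j x * c k y * K x y :=
        Finset.sum_congr rfl fun x _ => Finset.sum_comm
    _ = ∑ j ∈ T, ∑ x ∈ s, ∑ y ∈ s, ∑ k ∈ T, c j x * c k y * K x y := Finset.sum_comm
    _ = ∑ j ∈ T, ∑ x ∈ s, ∑ k ∈ T, ∑ y ∈ s, c j x * c k y * K x y :=
        Finset.sum_congr rfl fun j _ => Finset.sum_congr rfl fun x _ => Finset.sum_comm
    _ = ∑ j ∈ T, ∑ k ∈ T, ∑ x ∈ s, ∑ y ∈ s, c j x * c k y * K x y :=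
        Finset.sum_congr rfl fun j _ => Finset.sum_comm

/-- **Counting/sup bound for a double sum.**  If `c` vanishes on `s` outside `A ⊆ s`, `d` vanishes on `s` outside
`B ⊆ s`, `|c| ≤ Cc`, `|d| ≤ Cd`, and `|K x y| ≤ M` whenever `x ∈ A`, `y ∈ B` carry non-zero coefficients, then
`|ΣΣ c x · d y · K x y| ≤ #A · #B · (Cc · Cd · M)`. [folklore] -/
theorem abs_sum_sum_le_card_mul (s A B : Finset X) (hA : A ⊆ s) (hB : B ⊆ s) (c d : X → ℝ) (K : X → X → ℝ)
    {Cc Cd M : ℝ} (hCc : 0 ≤ Cc) (hCd : 0 ≤ Cd) (hM : 0 ≤ M)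
    (hcA : ∀ x ∈ s, c x ≠ 0 → x ∈ A) (hdB : ∀ y ∈ s, d y ≠ 0 → y ∈ B)
    (hc : ∀ x, |c x| ≤ Cc) (hd : ∀ y, |d y| ≤ Cd)
    (hK : ∀ x ∈ A, ∀ y ∈ B, c x ≠ 0 → d y ≠ 0 → |K x y| ≤ M) :
    |∑ x ∈ s, ∑ y ∈ s, c x * d y * K x y| ≤ (A.card : ℝ) * B.card * (Cc * Cd * M) := by
  -- restrict both sums to `A`, `B`
  have hin : ∀ x, ∑ y ∈ s, c x * d y * K x y = ∑ y ∈ B, c x * d y * K x y := by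
    intro x
    refine (Finset.sum_subset hB fun y hy hyB => ?_).symm
    have : d y = 0 := by
      by_contra h
      exact hyB (hdB y hy h)
    simp [this]
  have hout : ∑ x ∈ s, ∑ y ∈ B, c x * d y * K x y = ∑ x ∈ A, ∑ y ∈ B, c x * d y * K x y := by
    refine (Finset.sum_subset hA fun x hx hxA => ?_).symm
    have : c x = 0 := by
      by_contra h
      exact hxA (hcA x hx h)
    simp [this]
  simp_rw [hin]
  rw [hout]
  -- bound each term
  have hterm : ∀ x ∈ A, ∀ y ∈ B, |c x * d y * K x y| ≤ Cc * Cd * M := by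
    intro x hx y hy
    by_cases hcx : c x = 0
    · rw [hcx]; simp only [zero_mul, abs_zero]; positivity
    by_cases hdy : d y = 0
    · rw [hdy]; simp only [mul_zero, zero_mul, abs_zero]; positivity
    rw [abs_mul, abs_mul]
    exact mul_le_mul (mul_le_mul (hc x) (hd y) (abs_nonneg _) hCc) (hK x hx y hy hcx hdy) (abs_nonneg _)
      (mul_nonneg hCc hCd)
  calc |∑ x ∈ A, ∑ y ∈ B, c x * d y * K x y|
      ≤ ∑ x ∈ A, |∑ y ∈ B, c x * d y * K x y| := Finset.abs_sum_le_sum_abs _ _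
    _ ≤ ∑ x ∈ A, ∑ y ∈ B, |c x * d y * K x y| :=
        Finset.sum_le_sum fun x _ => Finset.abs_sum_le_sum_abs _ _
    _ ≤ ∑ x ∈ A, ∑ y ∈ B, Cc * Cd * M :=
        Finset.sum_le_sum fun x hx => Finset.sum_le_sum fun y hy => hterm x hx y hy
    _ = (A.card : ℝ) * B.card * (Cc * Cd * M) := by
        simp only [Finset.sum_const, nsmul_eq_mul]; ring

/-- **Perturbation bound.**  Two coefficient functions `f, g` with `|f|, |g| ≤ 1`, both vanishing on `s` outside
`N ⊆ s`, with `|f − g| ≤ δ`, and a kernel with `|K| ≤ M` on pairs of `N` carrying non-zero coefficients: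
`|ΣΣ f f K − ΣΣ g g K| ≤ 2 · #N² · δ · M`. [folklore] -/
theorem abs_sum_sum_sub_sum_sum_le (s N : Finset X) (hN : N ⊆ s) (f g : X → ℝ) (K : X → X → ℝ)
    {δ M : ℝ} (hδ : 0 ≤ δ) (hM : 0 ≤ M)
    (hfN : ∀ x ∈ s, f x ≠ 0 → x ∈ N) (hgN : ∀ x ∈ s, g x ≠ 0 → x ∈ N)
    (hf : ∀ x, |f x| ≤ 1) (hg : ∀ x, |g x| ≤ 1) (hfg : ∀ x, |f x - g x| ≤ δ)
    (hK : ∀ x ∈ N, ∀ y ∈ N, (f x ≠ 0 ∨ g x ≠ 0) → (f y ≠ 0 ∨ g y ≠ 0) → |K x y| ≤ M) :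
    |(∑ x ∈ s, ∑ y ∈ s, f x * f y * K x y) - ∑ x ∈ s, ∑ y ∈ s, g x * g y * K x y| ≤
      2 * ((N.card : ℝ) * N.card) * (δ * M) := by
  have hsplit : (∑ x ∈ s, ∑ y ∈ s, f x * f y * K x y) - ∑ x ∈ s, ∑ y ∈ s, g x * g y * K x y =
      (∑ x ∈ s, ∑ y ∈ s, (f x - g x) * f y * K x y) + ∑ x ∈ s, ∑ y ∈ s, g x * (f y - g y) * K x y := by
    rw [← Finset.sum_sub_distrib, ← Finset.sum_add_distrib]
    refine Finset.sum_congr rfl fun x _ => ?_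
    rw [← Finset.sum_sub_distrib, ← Finset.sum_add_distrib]
    refine Finset.sum_congr rfl fun y _ => ?_
    ring
  have hdN : ∀ x ∈ s, f x - g x ≠ 0 → x ∈ N := by
    intro x hx h
    by_cases hfx : f x = 0
    · have : g x ≠ 0 := fun h' => h (by rw [hfx, h', sub_zero])
      exact hgN x hx this
    · exact hfN x hx hfx
  have h1 := abs_sum_sum_le_card_mul s N N hN hN (fun x => f x - g x) f K hδ zero_le_one hM hdN hfN hfg hf
    (fun x hx y hy hx' hy' => hK x hx y hy (by
      by_cases hfx : f x = 0
      · exact Or.inr fun h' => hx' (by rw [hfx, h', sub_zero])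
      · exact Or.inl hfx) (Or.inl hy'))
  have h2 := abs_sum_sum_le_card_mul s N N hN hN g (fun y => f y - g y) K zero_le_one hδ hM hgN hdN hg hfg
    (fun x hx y hy hx' hy' => hK x hx y hy (Or.inr hx') (by
      by_cases hfy : f y = 0
      · exact Or.inr fun h' => hy' (by rw [hfy, h', sub_zero])
      · exact Or.inl hfy))
  rw [hsplit]
  calc |(∑ x ∈ s, ∑ y ∈ s, (f x - g x) * f y * K x y) + ∑ x ∈ s, ∑ y ∈ s, g x * (f y - g y) * K x y|
      ≤ |∑ x ∈ s, ∑ y ∈ s, (f x - g x) * f y * K x y| + |∑ x ∈ s, ∑ y ∈ s, g x * (f y - g y) * K x y| :=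
        abs_add_le _ _
    _ ≤ (N.card : ℝ) * N.card * (δ * 1 * M) + (N.card : ℝ) * N.card * (1 * δ * M) := add_le_add h1 h2
    _ = 2 * ((N.card : ℝ) * N.card) * (δ * M) := by ring

end DoubleSums

/-! ## §1b Re-indexing box sums by a lattice translation -/

section Shift

/-- A box sum of a function supported in `box ∩ (box − n)` is unchanged by the shift `x ↦ x − n`. [folklore] -/
theorem sum_box_comp_sub (L : ℕ) (h : (Fin 4 → ℤ) → ℝ) (n : Fin 4 → ℤ)
    (hh : ∀ x, h x ≠ 0 → x ∈ box 4 L ∧ x + n ∈ box 4 L) :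
    ∑ x ∈ box 4 L, h (x - n) = ∑ x ∈ box 4 L, h x := by
  have hs1 : Function.support (fun x => h (x - n)) ⊆ ↑(box 4 L) := by
    intro x hx
    have := (hh (x - n) hx).2
    rwa [sub_add_cancel] at this
  have hs2 : Function.support h ⊆ ↑(box 4 L) := fun x hx => (hh x hx).1
  rw [← finsum_eq_sum_of_support_subset _ hs1, ← finsum_eq_sum_of_support_subset _ hs2]
  exact finsum_comp_equiv (Equiv.subRight n) (f := h)

/-- **Re-indexing a double box sum by a lattice translation.**  If the coefficient function `c` is supported in
`box ∩ (box − n)`, then `ΣΣ c(x−n) c(y−n) K(x,y) = ΣΣ c(x) c(y) K(x+n, y+n)`. [folklore] -/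
theorem sum_sum_box_shift (L : ℕ) (c : (Fin 4 → ℤ) → ℝ) (K : (Fin 4 → ℤ) → (Fin 4 → ℤ) → ℝ) (n : Fin 4 → ℤ)
    (hc : ∀ x, c x ≠ 0 → x ∈ box 4 L ∧ x + n ∈ box 4 L) :
    ∑ x ∈ box 4 L, ∑ y ∈ box 4 L, c (x - n) * c (y - n) * K x y =
      ∑ x ∈ box 4 L, ∑ y ∈ box 4 L, c x * c y * K (x + n) (y + n) := by
  set Φ : (Fin 4 → ℤ) → (Fin 4 → ℤ) → ℝ := fun x y => c x * c y * K (x + n) (y + n) with hΦ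
  have e1 : ∀ x y, c (x - n) * c (y - n) * K x y = Φ (x - n) (y - n) := by
    intro x y; simp only [hΦ, sub_add_cancel]
  simp_rw [e1]
  have inner : ∀ x, ∑ y ∈ box 4 L, Φ (x - n) (y - n) = ∑ y ∈ box 4 L, Φ (x - n) y := by
    intro x
    refine sum_box_comp_sub L (Φ (x - n)) n fun y hy => hc y ?_
    intro h0
    exact hy (by simp only [hΦ, h0, mul_zero, zero_mul])
  simp_rw [inner]
  refine sum_box_comp_sub L (fun x => ∑ y ∈ box 4 L, Φ x y) n fun x hx => hc x ?_
  intro h0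
  exact hx (Finset.sum_eq_zero fun y _ => by simp only [hΦ, h0, zero_mul])

end Shift

/-! ## §2 Counting lattice sites in a ball -/

section Count

/-- For `s > 0`, `ρ ≥ 0`, `c ∈ ℝ⁴`: the sites `y` of a box with `‖s·y − c‖ ≤ ρ` number at most `((2ρ + s)/s)⁴` (each
coordinate of such a `y` lies in an interval of length `2ρ/s`). [folklore] -/
theorem card_filter_norm_sub_le (L : ℕ) {s : ℝ} (hs : 0 < s) (c : EuclideanSpace ℝ (Fin 4)) {ρ : ℝ} (hρ : 0 ≤ ρ) :
    (((box 4 L).filter fun y => ‖s • siteToE y - c‖ ≤ ρ).card : ℝ) ≤ ((2 * ρ + s) / s) ^ 4 := by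
  classical
  set P : Fin 4 → Finset ℤ := fun i => Finset.Icc ⌈(c i - ρ) / s⌉ ⌊(c i + ρ) / s⌋ with hP
  have hsub : ((box 4 L).filter fun y => ‖s • siteToE y - c‖ ≤ ρ) ⊆ Fintype.piFinset P := by
    intro y hy
    rw [Finset.mem_filter] at hy
    rw [Fintype.mem_piFinset]
    intro i
    have hi : |s * (y i : ℝ) - c i| ≤ ρ := by
      have h1 : ‖(s • siteToE y - c) i‖ ≤ ‖s • siteToE y - c‖ := PiLp.norm_apply_le _ _
      have h2 : (s • siteToE y - c) i = s * (y i : ℝ) - c i := by simp [siteToE_apply]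
      rw [h2, Real.norm_eq_abs] at h1
      exact h1.trans hy.2
    rw [abs_le] at hi
    simp only [hP, Finset.mem_Icc]
    constructor
    · rw [Int.ceil_le, div_le_iff₀ hs]; linarith
    · rw [Int.le_floor, le_div_iff₀ hs]; linarith
  have hcard : (((box 4 L).filter fun y => ‖s • siteToE y - c‖ ≤ ρ).card : ℝ) ≤
      ((Fintype.piFinset P).card : ℝ) := by
    exact_mod_cast Finset.card_le_card hsub
  refine hcard.trans ?_
  rw [Fintype.card_piFinset, Nat.cast_prod]
  have heach : ∀ i, ((P i).card : ℝ) ≤ (2 * ρ + s) / s := by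
    intro i
    have h0 : ((⌊(c i + ρ) / s⌋ + 1 - ⌈(c i - ρ) / s⌉ : ℤ) : ℝ) ≤ (2 * ρ + s) / s := by
      push_cast
      have h1 : ((⌊(c i + ρ) / s⌋ : ℤ) : ℝ) ≤ (c i + ρ) / s := Int.floor_le _
      have h2 : (c i - ρ) / s ≤ ((⌈(c i - ρ) / s⌉ : ℤ) : ℝ) := Int.le_ceil _
      have : (c i + ρ) / s + 1 - (c i - ρ) / s = (2 * ρ + s) / s := by
        field_simp
        ring
      linarith
    have hc : (((P i).card : ℕ) : ℝ) = max (((⌊(c i + ρ) / s⌋ + 1 - ⌈(c i - ρ) / s⌉ : ℤ)) : ℝ) 0 := by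
      rw [hP, Int.card_Icc, ← Int.cast_natCast, Int.toNat_eq_max]
      push_cast
      rfl
    rw [hc]
    exact max_le h0 (by positivity)
  calc ∏ i, ((P i).card : ℝ) ≤ ∏ _i : Fin 4, (2 * ρ + s) / s :=
        Finset.prod_le_prod (fun i _ => by positivity) fun i _ => heach i
    _ = ((2 * ρ + s) / s) ^ 4 := by rw [Finset.prod_const, Finset.card_univ, Fintype.card_fin]

end Count


/-! ## §3 Small geometric lemmas in `ℝ⁴` -/

/-- Coordinates of the embedded site: `(s·y − t·e₁)_i = s·y_i − t·δ_{i1}`. [folklore] -/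
theorem smul_siteToE_sub_single_apply (s t : ℝ) (y : Fin 4 → ℤ) (i : Fin 4) :
    (s • siteToE y - EuclideanSpace.single (1 : Fin 4) t : EuclideanSpace ℝ (Fin 4)) i =
      s * (y i : ℝ) - (if i = 1 then t else 0) := by
  simp [siteToE_apply]

/-- The lattice rounding of the offset `t·e₁`: `‖s·(round(t/s)·e₁) − t·e₁‖ ≤ s` (`s > 0`). [folklore] -/
theorem norm_smul_siteToE_single_round_sub_le {s : ℝ} (hs : 0 < s) (t : ℝ) :
    ‖s • siteToE (Pi.single (1 : Fin 4) (round (t / s)) : Fin 4 → ℤ) - EuclideanSpace.single (1 : Fin 4) t‖ ≤ s := by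
  have e : s • siteToE (Pi.single (1 : Fin 4) (round (t / s)) : Fin 4 → ℤ) - EuclideanSpace.single (1 : Fin 4) t =
      EuclideanSpace.single (1 : Fin 4) (s * (round (t / s) : ℤ) - t) := by
    ext i
    by_cases hi : i = 1
    · subst hi; simp [siteToE_apply]
    · simp [siteToE_apply, hi]
  rw [e, PiLp.norm_single, Real.norm_eq_abs]
  have h1 : |t / s - (round (t / s) : ℤ)| ≤ 1 / 2 := abs_sub_round (t / s)
  have h2 : s * (round (t / s) : ℤ) - t = -(s * (t / s - (round (t / s) : ℤ))) := by
    field_simp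
    ring
  rw [h2, abs_neg, abs_mul, abs_of_pos hs]
  nlinarith

/-- The mirror-separation vector dominates the time sum: `|x₀ + y₀| ≤ ‖(x₀+y₀, x⃗−y⃗)‖`. [folklore] -/
theorem abs_time_le_norm_mirrorSep (x y : Fin 4 → ℤ) :
    |((x 0 + y 0 : ℤ) : ℝ)| ≤ ‖siteToE (Function.update (x - y) 0 (x 0 + y 0))‖ := by
  have h := PiLp.norm_apply_le (siteToE (Function.update (x - y) 0 (x 0 + y 0))) 0
  simpa [siteToE_apply] using h

/-- The mirror-separation vector dominates the first spatial difference: `|x₁ − y₁| ≤ ‖(x₀+y₀, x⃗−y⃗)‖`. [folklore] -/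
theorem abs_space_le_norm_mirrorSep (x y : Fin 4 → ℤ) :
    |((x 1 - y 1 : ℤ) : ℝ)| ≤ ‖siteToE (Function.update (x - y) 0 (x 0 + y 0))‖ := by
  have h := PiLp.norm_apply_le (siteToE (Function.update (x - y) 0 (x 0 + y 0))) 1
  have h1 : (1 : Fin 4) ≠ 0 := by decide
  simpa [siteToE_apply, Function.update_of_ne h1] using h

/-- A site whose scaled embedding has norm `≤ s·L` lies in `box 4 L`. [folklore] -/
theorem mem_box_of_norm_smul_le (L : ℕ) {s : ℝ} (hs : 0 < s) (y : Fin 4 → ℤ) (h : ‖s • siteToE y‖ ≤ s * L) :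
    y ∈ box 4 L := by
  rw [mem_box]
  intro i
  have h1 : ‖(s • siteToE y) i‖ ≤ ‖s • siteToE y‖ := PiLp.norm_apply_le _ _
  have h2 : (s • siteToE y) i = s * (y i : ℝ) := by simp [siteToE_apply]
  rw [h2, Real.norm_eq_abs, abs_mul, abs_of_pos hs] at h1
  have h3 : |(y i : ℝ)| ≤ L := le_of_mul_le_mul_left (h1.trans h) hs
  rw [abs_le] at h3
  exact ⟨by exact_mod_cast h3.1, by exact_mod_cast h3.2⟩


/-! ## §4 More geometry: coordinates, separation floors, the window predicate -/

section Window

/-- Time coordinate of `s·y − t·e₁`. [folklore] -/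
theorem smul_siteToE_sub_single_zero (s t : ℝ) (y : Fin 4 → ℤ) :
    (s • siteToE y - EuclideanSpace.single (1 : Fin 4) t : EuclideanSpace ℝ (Fin 4)) 0 = s * (y 0 : ℝ) := by
  rw [smul_siteToE_sub_single_apply]; simp

/-- First spatial coordinate of `s·y − t·e₁`. [folklore] -/
theorem smul_siteToE_sub_single_one (s t : ℝ) (y : Fin 4 → ℤ) :
    (s • siteToE y - EuclideanSpace.single (1 : Fin 4) t : EuclideanSpace ℝ (Fin 4)) 1 = s * (y 1 : ℝ) - t := by
  rw [smul_siteToE_sub_single_apply]; simp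

/-- Kernel ceiling below a separation floor: `|K| ≤ C/‖w‖⁸` and `0 < m ≤ ‖w‖` give `|K| ≤ C/m⁸`. [folklore] -/
theorem abs_le_div_pow_of_le {k C w m : ℝ} (hC : 0 ≤ C) (hm : 0 < m) (hmw : m ≤ w) (hk : |k| ≤ C / w ^ 8) :
    |k| ≤ C / m ^ 8 :=
  hk.trans (div_le_div_of_nonneg_left hC (by positivity) (pow_le_pow_left₀ hm.le hmw 8))

/-- **Window bookkeeping.**  A site `y` with `δ ≤ s·y₀` (`δ > 0`) and `‖s·y − t·e₁‖ ≤ ℓ + s` (`t ≥ 0`) has `y₀ ≥ 1`,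
`‖s·y‖ ≤ R` for any `R ≥ ℓ + s + t`, and lies in `box 4 L` once `R ≤ s·L`. [folklore] -/
theorem window_of_near (L : ℕ) {s ℓ δ t R : ℝ} (hs : 0 < s) (hδ : 0 < δ) (ht : 0 ≤ t) (hR : ℓ + s + t ≤ R)
    (hRL : R ≤ s * L) (y : Fin 4 → ℤ) (h0 : δ ≤ s * y 0)
    (h1 : ‖s • siteToE y - EuclideanSpace.single 1 t‖ ≤ ℓ + s) :
    1 ≤ y 0 ∧ ‖s • siteToE y‖ ≤ R ∧ y ∈ box 4 L := by
  have hy0 : (0 : ℝ) < y 0 := (mul_pos_iff_of_pos_left hs).mp (lt_of_lt_of_le hδ h0)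
  have hy0' : (0 : ℤ) < y 0 := by exact_mod_cast hy0
  have hc : ‖(EuclideanSpace.single (1 : Fin 4) t : EuclideanSpace ℝ (Fin 4))‖ = t := by
    rw [PiLp.norm_single, Real.norm_eq_abs, abs_of_nonneg ht]
  have h2 : ‖s • siteToE y‖ ≤ R := by
    have := norm_sub_norm_le (s • siteToE y) (EuclideanSpace.single 1 t)
    rw [hc] at this
    linarith
  exact ⟨by omega, h2, mem_box_of_norm_smul_le L hs y (h2.trans hRL)⟩

end Window


/-! ## §5 Room arithmetic -/

section Room

/-- **Room arithmetic.**  For `p < 8`, `A ≥ 0`, `T > 0`: `(4J+2)·ℓ + J·A·ℓ^(1−p/8) < T` for all small `ℓ > 0`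
(continuity at `0` of `ℓ ↦ ℓ^(1−p/8)`, exponent `1 − p/8 > 0`). [folklore] -/
theorem exists_room (J : ℕ) {p : ℝ} (hp : p < 8) {A T : ℝ} (hT : 0 < T) :
    ∃ ℓ₁ : ℝ, 0 < ℓ₁ ∧ ∀ ℓ : ℝ, 0 < ℓ → ℓ < ℓ₁ → (4 * J + 2) * ℓ + J * A * ℓ ^ (1 - p / 8) < T := by
  have hq : 0 < 1 - p / 8 := by linarith
  have hc : ContinuousAt (fun ℓ : ℝ => (4 * J + 2) * ℓ + J * A * ℓ ^ (1 - p / 8)) 0 := by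
    have h1 : ContinuousAt (fun ℓ : ℝ => ℓ ^ (1 - p / 8)) 0 :=
      Real.continuousAt_rpow_const 0 (1 - p / 8) (Or.inr hq.le)
    exact (continuousAt_const.mul continuousAt_id).add (continuousAt_const.mul h1)
  have h0 : (fun ℓ : ℝ => (4 * J + 2) * ℓ + J * A * ℓ ^ (1 - p / 8)) 0 < T := by
    simp [Real.zero_rpow hq.ne', hT]
  have hmem : (fun ℓ : ℝ => (4 * J + 2) * ℓ + J * A * ℓ ^ (1 - p / 8)) ⁻¹' Set.Iio T ∈ 𝓝 (0 : ℝ) :=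
    hc (Iio_mem_nhds h0)
  obtain ⟨ε, hε, hball⟩ := Metric.mem_nhds_iff.mp hmem
  refine ⟨ε, hε, fun ℓ hℓ hℓε => hball ?_⟩
  rw [Metric.mem_ball, Real.dist_eq, sub_zero, abs_of_pos hℓ]
  exact hℓε

end Room

end Summit.QuantumFields.YangMills.Theorems.FiniteRankMirror

end
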